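import Summits.CriticalPhenomena.PercolationContinuityZ3.Theorems.PercNearOneGluingNoHeavyQuantSliceSingleLayer
import Summits.CriticalPhenomena.PercolationContinuityZ3.Theorems.PercNearOneGluingNoHeavyQuantFlowUncross
import HarnessLib

/-!
# QUANT lane R8, T-DEC: the single-layer domination conjecture REDUCED to two local rate lemmas — the layer is chosen from the prices
# (`J(Φ)` = the largest window atom priced below the cheapest giant), the giant conditions are proved, and what remains is the MID condition
# for the absorbers below the window (`LawDec.SliceMidLemmaD`) and for the window atoms under a cheap one (`LawDec.SliceMidLemmaW`)

builds on p205010 (kernel theorem, internal audit signed; external expert review pending)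

Statement + support file (`--supports stmt-CriticalPhenomena-4575`), QUANT lane seat prim-quant-census-2 (gen 55), rung R8 of
`run/shared/lean/prim/quant/LADDER.md`.  Memo `run/shared/lean/prim/quant/prim-quant-census-2-g55/SINGLE-LAYER-G55.md` §3.  Two `@[conjecture]`
`Prop`s (the two local lemmas), theorems with standard axioms, no sorries.  Continues `…QuantSliceSingleLayer` (this seat, p309331: `slicePullback`,
`SliceSingleLayer`, `slicePullback_nonpos_of_absorber`).

THE ARCHITECTURE (memo §3; verified exactly on 250 929 certificates, 0 failures, incl. certificates whose giants are priced `10⁶` so that only the local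
pairs bound the lows).  Fix a slice price system `(α, β)` at `(T′ = T + a·g, j′)` on `{0..M+a}` and let `q₀` be a CHEAPEST GIANT position (`j′+1 ≤ q₀ ≤ M+a`,
`β q₀ ≤ β q` for every giant position `q`).  Every slice low reaches every giant at the rate `x/(1−x)`, so the pullback satisfies `Φ(l) ≤ (x/(1−x))·β q₀`
for every low `l ≤ j′ − a` (`slicePullback_low_le_giant`), and an atom `h` whose combined price `−Φ(h)` is at least `β q₀` passes the GIANT test
`Φ(l) ≤ (x/(1−x))·(−Φ(h))` of every layer below it (`slicePullback_giant_condition`) — true giants `h ≥ j′+1` always do.  Call a window atom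
`h ∈ (j′−a, j′]`, `h ≤ M`, CHEAP if `−Φ(h) < β q₀`, and let `J(Φ) := max(j′ − a, largest cheap window atom)`.  At the layer `J(Φ)`: the absorber conditions
hold (`slicePullback_nonpos_of_absorber`), the window lows are harmless (`slicePullback_windowLow`), every window atom above `J(Φ)` is not cheap hence
passes the giant test, and what is LEFT is the mid condition `Φ(l) ≤ usage(l,h)·(−Φ(h))` for `l ≤ j′−a` and the `T`-compatible absorbers `h ≤ J(Φ)`:
those with `h ≤ j′ − a` (LEMMA D — for every certificate) and the window atoms `h ≤ J(Φ)`, which lie under the cheap atom `J(Φ)` (LEMMA W).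

* **`LawDec.SliceMidLemmaD`** (`@[conjecture]`) — the mid condition for absorbers `h ≤ j′ − a` (`T ≤ 2h`, `T < l + h`), every certificate.  Local form and exact
  scans (deep: 4 breakpoints of a concave piecewise-linear function of the two prices `β h, β (h+a)`, 1.9·10⁶ parameter cells, worst slack −5·10⁻⁵; shallow:
  worst slack 0 at `g = x`) in the memo §3.
* **`LawDec.SliceMidLemmaW`** (`@[conjecture]`) — the mid condition for a window atom `h` (`T ≤ 2h`, `T < l + h`) lying at or below a CHEAP window atom `h′`.
* **`LawDec.slicePullback_low_le_giant`**, **`slicePullback_giant_condition`**, **`slicePullback_trueGiant_expensive`** — the proved giant half.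
* **`LawDec.sliceSingleLayer_of_midLemmas : SliceMidLemmaD → SliceMidLemmaW → SliceSingleLayer`** — the reduction (hence, with p309331,
  `→ SliceDominated → SliceClosedAll` and `→ SliceClosedWindowT`).
HONEST: both lemmas, `SliceSingleLayer` and everything downstream remain OPEN; `SliceClosed`/`SliceClosedT` are FALSE; rate / honest sentence unchanged.

[this work]; memos SINGLE-LAYER-G55, SL-STRUCTURE-G54, LEAD-NOTES-G22 N47–N48 (this lane).  The gluing rows served [cite: KozmaNitzan2024, Conjecture 3 (p. 15)];
product measure [cite: Grimmett1999, §1.3 p. 10].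
-/

noncomputable section

namespace Summit.CriticalPhenomena.PercolationContinuityZ3.Theorems

namespace Quant

open Finset

namespace LawDec

/-! ### The two local lemmas (conjectures) -/

/-- **LEMMA D (mid condition below the window; census-2 g55, memo SINGLE-LAYER-G55 §3).**  For a slice price system `(α, β)` at `(T + ag, j′)` on `{0..M+a}`
(`0 < x < 1`, `x ≤ g ≤ 1`, `1 ≤ a`, `j′ < M + a`), a low `l` with `l + a ≤ j′`, `2l < T`, and an absorber `h ≤ M` with `h + a ≤ j′`, `T ≤ 2h`, `T < l + h`:
`Φ(l) ≤ usage x T J l h · (−Φ(h))` at every layer `J ≥ h` (the usage of a mid does not depend on the layer), `Φ = slicePullback (T+ag) g j′ a α β`.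
EVIDENCE: exact, 0 failures (architecture runs 600 k certificates; local breakpoint scans 2.5·10⁶ cells, sharp at `g = x`). [this work] [status: open] -/
@[conjecture] def SliceMidLemmaD : Prop :=
  ∀ (x g T : ℝ) (M a j' : ℕ) (α β : ℕ → ℝ),
    0 < x → x < 1 → x ≤ g → g ≤ 1 → 1 ≤ a → j' < M + a →
    (∀ h, 0 ≤ β h) →
    (∀ l h, l ≤ j' → 2 * (l : ℝ) < T + (a : ℝ) * g → h ≤ M + a →
      (j' + 1 ≤ h ∨ T + (a : ℝ) * g < (l : ℝ) + h) → α l ≤ usage x (T + (a : ℝ) * g) j' l h * β h) →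
    ∀ (l h J : ℕ), l + a ≤ j' → 2 * (l : ℝ) < T → h ≤ M → h + a ≤ j' → T ≤ 2 * (h : ℝ) → T < (l : ℝ) + h → h ≤ J →
      slicePullback (T + (a : ℝ) * g) g j' a α β l
        ≤ usage x T J l h * (- slicePullback (T + (a : ℝ) * g) g j' a α β h)

/-- **LEMMA W (mid condition for window atoms under a cheap one; census-2 g55, memo §3).**  Same frame; `q₀` a cheapest giant position
(`j′+1 ≤ q₀ ≤ M+a`, `β q₀ ≤ β q` for all giant positions `q ≤ M+a`); `h′ ≤ min(j′, M)` a window atom (`j′ < h′ + a`) that is CHEAP: `−Φ(h′) < β q₀`; then for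
every window atom `h ≤ h′` (`j′ < h + a`) with `T ≤ 2h` and every low `l` (`l + a ≤ j′`, `2l < T`, `T < l + h`): `Φ(l) ≤ usage x T J l h · (−Φ(h))` at every
layer `J ≥ h`.  EVIDENCE: exact, 0 failures (architecture runs, 600 k certificates). [this work] [status: open] -/
@[conjecture] def SliceMidLemmaW : Prop :=
  ∀ (x g T : ℝ) (M a j' : ℕ) (α β : ℕ → ℝ),
    0 < x → x < 1 → x ≤ g → g ≤ 1 → 1 ≤ a → j' < M + a →
    (∀ h, 0 ≤ β h) →
    (∀ l h, l ≤ j' → 2 * (l : ℝ) < T + (a : ℝ) * g → h ≤ M + a →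
      (j' + 1 ≤ h ∨ T + (a : ℝ) * g < (l : ℝ) + h) → α l ≤ usage x (T + (a : ℝ) * g) j' l h * β h) →
    ∀ (q₀ : ℕ), j' + 1 ≤ q₀ → q₀ ≤ M + a → (∀ q, j' + 1 ≤ q → q ≤ M + a → β q₀ ≤ β q) →
    ∀ (h' : ℕ), h' ≤ j' → h' ≤ M → j' < h' + a →
      - slicePullback (T + (a : ℝ) * g) g j' a α β h' < β q₀ →
    ∀ (l h J : ℕ), l + a ≤ j' → 2 * (l : ℝ) < T → h ≤ h' → j' < h + a → T ≤ 2 * (h : ℝ) → T < (l : ℝ) + h → h ≤ J →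
      slicePullback (T + (a : ℝ) * g) g j' a α β l
        ≤ usage x T J l h * (- slicePullback (T + (a : ℝ) * g) g j' a α β h)

/-! ### The giant half (proved) -/

section Frame

variable (x g T : ℝ) (M a j' : ℕ) (α β : ℕ → ℝ)
  (hx0 : 0 < x) (hx1 : x < 1) (hxg : x ≤ g) (hg1 : g ≤ 1)
  (hβ : ∀ h, 0 ≤ β h)
  (hαβ : ∀ l h, l ≤ j' → 2 * (l : ℝ) < T + (a : ℝ) * g → h ≤ M + a →
    (j' + 1 ≤ h ∨ T + (a : ℝ) * g < (l : ℝ) + h) → α l ≤ usage x (T + (a : ℝ) * g) j' l h * β h)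

include hx0 hxg hg1 hβ hαβ in
/-- **every low is worth at most `x/(1−x)` times any giant price**: for `l + a ≤ j′`, `2l < T` and a giant position `j′+1 ≤ q ≤ M+a`,
`Φ(l) ≤ (x/(1−x))·β q` (both copies of `l` reach `q` by rule (G); a row-1 copy that is a slice absorber contributes `−β ≤ 0`). [this work] -/
theorem slicePullback_low_le_giant (l q : ℕ) (hla : l + a ≤ j') (hlow : 2 * (l : ℝ) < T) (hq1 : j' + 1 ≤ q) (hqM : q ≤ M + a) :
    slicePullback (T + (a : ℝ) * g) g j' a α β l ≤ x / (1 - x) * β q := by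
  have hg0 : 0 ≤ g := hx0.le.trans hxg
  have ha0 : (0 : ℝ) ≤ (a : ℝ) * g := mul_nonneg (Nat.cast_nonneg a) hg0
  have hux : 0 ≤ x / (1 - x) := div_nonneg hx0.le (by linarith)
  have hbq := hβ q
  have hlowT' : 2 * (l : ℝ) < T + (a : ℝ) * g := by linarith
  -- row-0 copy
  have h0 : coefAt (T + (a : ℝ) * g) j' α β l ≤ x / (1 - x) * β q := by
    unfold coefAt
    rw [if_pos ⟨by omega, hlowT'⟩]
    have := hαβ l q (by omega) hlowT' hqM (Or.inl hq1)
    rwa [usage_giant_eq x _ j' l q hq1] at this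
  -- row-1 copy
  have h1 : coefAt (T + (a : ℝ) * g) j' α β (l + a) ≤ x / (1 - x) * β q := by
    unfold coefAt
    by_cases hc : l + a ≤ j' ∧ 2 * ((l + a : ℕ) : ℝ) < T + (a : ℝ) * g
    · rw [if_pos hc]
      have := hαβ (l + a) q hc.1 hc.2 hqM (Or.inl hq1)
      rwa [usage_giant_eq x _ j' (l + a) q hq1] at this
    · rw [if_neg hc]
      have := hβ (l + a)
      nlinarith
  unfold slicePullback
  have h1g : 0 ≤ 1 - g := by linarith
  nlinarith [mul_le_mul_of_nonneg_left h0 h1g, mul_le_mul_of_nonneg_left h1 hg0]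

include hx0 hx1 hxg hg1 hβ hαβ in
/-- **the giant test**: if the combined price `−Φ(h)` of an atom `h ≥ J+1` is at least some giant price `β q` (`j′+1 ≤ q ≤ M+a`), then every low
`l + a ≤ j′`, `2l < T` satisfies `Φ(l) ≤ usage x T J l h · (−Φ(h))`. [this work] -/
theorem slicePullback_giant_condition (l h J q : ℕ) (hla : l + a ≤ j') (hlow : 2 * (l : ℝ) < T) (hq1 : j' + 1 ≤ q) (hqM : q ≤ M + a)
    (hJh : J + 1 ≤ h) (hexp : β q ≤ - slicePullback (T + (a : ℝ) * g) g j' a α β h) :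
    slicePullback (T + (a : ℝ) * g) g j' a α β l
      ≤ usage x T J l h * (- slicePullback (T + (a : ℝ) * g) g j' a α β h) := by
  rw [usage_giant_eq x T J l h hJh]
  have hux : 0 ≤ x / (1 - x) := div_nonneg hx0.le (by linarith)
  exact (slicePullback_low_le_giant x g T M a j' α β hx0 hxg hg1 hβ hαβ l q hla hlow hq1 hqM).trans
    (mul_le_mul_of_nonneg_left hexp hux)

include hx0 hxg hg1 in
/-- **true giants are expensive**: for `j′+1 ≤ h ≤ M` and a cheapest giant position `q₀`, `β q₀ ≤ −Φ(h) = (1−g)β h + gβ(h+a)`. [this work] -/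
theorem slicePullback_trueGiant_expensive (h q₀ : ℕ) (hh1 : j' + 1 ≤ h) (hhM : h ≤ M)
    (hq₀ : ∀ q, j' + 1 ≤ q → q ≤ M + a → β q₀ ≤ β q) :
    β q₀ ≤ - slicePullback (T + (a : ℝ) * g) g j' a α β h := by
  have hg0 : 0 ≤ g := hx0.le.trans hxg
  unfold slicePullback coefAt
  rw [if_neg (fun hc => by omega), if_neg (fun hc => by omega)]
  have e1 := hq₀ h hh1 (by omega)
  have e2 := hq₀ (h + a) (by omega) (by omega)
  nlinarith

end Frame

/-! ### The reduction -/

/-- **`SliceMidLemmaD → SliceMidLemmaW → SliceSingleLayer`** (memo SINGLE-LAYER-G55 §3): take a cheapest giant position `q₀`, the set `C` of cheap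
window atoms (`j′−a < h ≤ min(j′,M)`, `−Φ(h) < β q₀`) and `J := max' C` if `C ≠ ∅`, else `J := j′ − a`.  Absorber conditions: `slicePullback_nonpos_of_absorber`.
Low conditions: window lows by `slicePullback_windowLow` (`usage > 0`); for `l + a ≤ j′`: absorbers `h ≥ J+1` are true giants or non-cheap window atoms —
`slicePullback_giant_condition`; `T`-compatible `h ≤ J` are mids below the window (LEMMA D) or window atoms under the cheap atom `J` (LEMMA W). [this work] -/
theorem sliceSingleLayer_of_midLemmas (hD : SliceMidLemmaD) (hW : SliceMidLemmaW) : SliceSingleLayer := by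
  classical
  intro x g T M a j' α β hx0 hx1 hxg hg1 ha hjM hβ hαβ
  set Φ : ℕ → ℝ := slicePullback (T + (a : ℝ) * g) g j' a α β with hΦ
  -- a cheapest giant position
  have hne : (Finset.Icc (j' + 1) (M + a)).Nonempty := ⟨j' + 1, Finset.mem_Icc.2 ⟨le_rfl, by omega⟩⟩
  obtain ⟨q₀, hq₀mem, hq₀min⟩ := Finset.exists_min_image (Finset.Icc (j' + 1) (M + a)) β hne
  rw [Finset.mem_Icc] at hq₀mem
  have hq₀ : ∀ q, j' + 1 ≤ q → q ≤ M + a → β q₀ ≤ β q := fun q h1 h2 => hq₀min q (Finset.mem_Icc.2 ⟨h1, h2⟩)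
  -- the cheap window atoms
  set C : Finset ℕ := (Finset.Icc (j' + 1 - a) (min j' M)).filter (fun h => - Φ h < β q₀) with hC
  have hCmem : ∀ h, h ∈ C ↔ (j' < h + a ∧ h ≤ j' ∧ h ≤ M) ∧ - Φ h < β q₀ := by
    intro h
    rw [hC, Finset.mem_filter, Finset.mem_Icc]
    constructor
    · rintro ⟨⟨h1, h2⟩, h3⟩
      exact ⟨⟨by omega, le_trans h2 (min_le_left _ _), le_trans h2 (min_le_right _ _)⟩, h3⟩
    · rintro ⟨⟨h1, h2, h3⟩, h4⟩
      exact ⟨⟨by omega, le_min h2 h3⟩, h4⟩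
  -- the layer
  let J : ℕ := if hCne : C.Nonempty then C.max' hCne else j' - a
  have hJwin : j' ≤ J + a ∧ J ≤ j' ∧ J ≤ M := by
    by_cases hCne : C.Nonempty
    · have hJ : J = C.max' hCne := by simp only [J, dif_pos hCne]
      have hm := ((hCmem _).1 (Finset.max'_mem C hCne)).1
      rw [hJ]
      exact ⟨by omega, hm.2.1, hm.2.2⟩
    · have hJ : J = j' - a := by simp only [J, dif_neg hCne]
      rw [hJ]
      omega
  -- window atoms above J are not cheap
  have hnotcheap : ∀ h, J + 1 ≤ h → h ≤ j' → h ≤ M → β q₀ ≤ - Φ h := by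
    intro h h1 h2 h3
    by_contra hle
    have hlt : - Φ h < β q₀ := not_le.1 hle
    have hmem : h ∈ C := (hCmem h).2 ⟨⟨by omega, h2, h3⟩, hlt⟩
    have hCne : C.Nonempty := ⟨h, hmem⟩
    have hJ : J = C.max' hCne := by simp only [J, dif_pos hCne]
    have := Finset.le_max' C h hmem
    omega
  -- if a window atom lies at or below J then J is a cheap window atom
  have hJcheap : ∀ h, h ≤ J → j' < h + a → 0 < h → (J ≤ j' ∧ J ≤ M ∧ j' < J + a) ∧ - Φ J < β q₀ := by
    intro h h1 h2 h0
    by_cases hCne : C.Nonempty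
    · have hJ : J = C.max' hCne := by simp only [J, dif_pos hCne]
      have hm := (hCmem _).1 (Finset.max'_mem C hCne)
      rw [hJ]
      exact ⟨⟨hm.1.2.1, hm.1.2.2, hm.1.1⟩, hm.2⟩
    · have hJ : J = j' - a := by simp only [J, dif_neg hCne]
      exfalso
      omega
  refine ⟨J, hJwin.1, hJwin.2.1, hJwin.2.2, ?_, ?_⟩
  · -- absorber conditions
    intro h hhM hnl
    by_cases hT : T ≤ 2 * (h : ℝ)
    · exact slicePullback_nonpos_of_absorber x g T M a j' α β hx0 hx1 hxg hg1 ha hβ hαβ h hhM (Or.inl hT)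
    · have hJh : J < h := by
        by_contra hle
        exact hnl ⟨not_lt.1 hle, not_le.1 hT⟩
      exact slicePullback_nonpos_of_absorber x g T M a j' α β hx0 hx1 hxg hg1 ha hβ hαβ h hhM (Or.inr (by omega))
  · -- low conditions
    intro l h hlJ hlow hhM hcomp
    have hlh : l < h := by
      rcases hcomp with hc | hc
      · omega
      · have : (l : ℝ) < h := by linarith
        exact_mod_cast this
    -- the absorber h has −Φ h ≥ 0
    have habs : 0 ≤ - Φ h := by
      have hor : T ≤ 2 * (h : ℝ) ∨ j' < h + a := by
        rcases hcomp with hc | hc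
        · right; omega
        · left; linarith
      linarith [slicePullback_nonpos_of_absorber x g T M a j' α β hx0 hx1 hxg hg1 ha hβ hαβ h hhM hor]
    have hupos : 0 < usage x T J l h := usage_pos_of_compat x T J l h hx0 hx1 hlow hlh hcomp
    by_cases hwl : j' < l + a
    · -- window low: Φ l ≤ 0 ≤ usage · (−Φ h)
      have h0 := slicePullback_windowLow x g T M a j' α β hx0 hx1 hxg hg1 ha hβ hαβ l (by omega) hwl
      have : 0 ≤ usage x T J l h * (- Φ h) := mul_nonneg hupos.le habs
      linarith
    · have hla : l + a ≤ j' := not_lt.1 hwl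
      rcases hcomp with hJh | hmid
      · -- h ≥ J + 1: a true giant or a non-cheap window atom
        by_cases hg' : j' + 1 ≤ h
        · exact slicePullback_giant_condition x g T M a j' α β hx0 hx1 hxg hg1 hβ hαβ l h J q₀ hla hlow hq₀mem.1 hq₀mem.2 hJh
            (slicePullback_trueGiant_expensive x g T M a j' α β hx0 hxg hg1 h q₀ hg' hhM hq₀)
        · exact slicePullback_giant_condition x g T M a j' α β hx0 hx1 hxg hg1 hβ hαβ l h J q₀ hla hlow hq₀mem.1 hq₀mem.2 hJh
            (hnotcheap h hJh (by omega) hhM)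
      · -- T < l + h: a mid at layer J (h ≤ J, else it is a giant and the previous case applies with `Or.inl`)
        by_cases hJh : J + 1 ≤ h
        · by_cases hg' : j' + 1 ≤ h
          · exact slicePullback_giant_condition x g T M a j' α β hx0 hx1 hxg hg1 hβ hαβ l h J q₀ hla hlow hq₀mem.1 hq₀mem.2 hJh
              (slicePullback_trueGiant_expensive x g T M a j' α β hx0 hxg hg1 h q₀ hg' hhM hq₀)
          · exact slicePullback_giant_condition x g T M a j' α β hx0 hx1 hxg hg1 hβ hαβ l h J q₀ hla hlow hq₀mem.1 hq₀mem.2 hJh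
              (hnotcheap h hJh (by omega) hhM)
        · have hhJ : h ≤ J := by omega
          have hT2 : T ≤ 2 * (h : ℝ) := by
            have : (l : ℝ) < h := by exact_mod_cast hlh
            linarith
          by_cases hD' : h + a ≤ j'
          · exact hD x g T M a j' α β hx0 hx1 hxg hg1 ha hjM hβ hαβ l h J hla hlow hhM hD' hT2 hmid hhJ
          · have hwin : j' < h + a := not_le.1 hD'
            obtain ⟨⟨hJ1, hJ2, hJ3⟩, hJc⟩ := hJcheap h hhJ hwin (by omega)
            exact hW x g T M a j' α β hx0 hx1 hxg hg1 ha hjM hβ hαβ q₀ hq₀mem.1 hq₀mem.2 hq₀ J hJ1 hJ2 hJ3 hJc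
              l h J hla hlow hhJ hwin hT2 hmid hhJ

end LawDec

end Quant

end Summit.CriticalPhenomena.PercolationContinuityZ3.Theorems
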